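import Summits.Schanuel.Schanuel.Theorems.ZilberEacDirectionalExplosion
import Summits.Schanuel.Schanuel.Theorems.ZilberEacPunctureDensityPoly
import HarnessLib

/-!
# The invariant-direction regime: genericity of the limit family (exploding or decaying transversal)

Zilber's Exponential-Algebraic Closedness, case ladder (host summit Schanuel, cell `pub-schanuel`,
seat 2, gen 11).  In the invariant-direction regime (`ZilberEacInvariantDirectionExistence`,
`ZilberEacInvariantDirectionDensity`) the exponential points of `W = polyFibredGraph g A f`
(`g(x + z q) = g(x)`) come in families escaping along `q` with transversal limits
`r_p = 2πi p + L` (`p ∈ ℤ^t`, `L = log a`) and limiting power coordinate `e^{g(r_p)}`; THEOREM L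
(`ZilberEacTransversalLimits`) then asks that the LIMIT FAMILY `U = {(e^{g(r_p)}, r_p)}` support no
nonzero polynomial.  This file proves that genericity when some lattice direction `ℓ₀` (all
`ℓ₀ⱼ ≠ 0`) has `Re g_D(2πi ℓ₀) ≠ 0`: along `p = n ℓ` (`ℓ` in the open cone of `ℓ₀`, a Zariski dense
set of directions by `coneLatticeDirections_dense`) the value `e^{g(r_p)}` explodes (THEOREM K₀′,
`ZilberEacDirectionalExplosion`) or decays (THEOREM J₀′, `ZilberEacDirectionalDominancePuncture`)
super-polynomially.

* `eventually_re_eval_ge_of_re_leadingForm_pos`, `tendsto_log_norm_exp_eval_div_log` — growth of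
  `Re g` along `n v + L`;
* `invariantDirection_limits_generic` — the genericity of `U`.

HONEST FRAMING: an elimination lemma; `EC(3,2)` OPEN; nothing here bears on Schanuel's conjecture
(EAC ⇏ SC).
-/

noncomputable section

open Complex MvPolynomial Filter Topology
open Literature.NumberTheory.Transcendental Literature.ModelTheory.Zilber

set_option linter.dupNamespace false

namespace Summit.Schanuel.Schanuel.Theorems

/-! ## Part A. Genericity of the limit family `(e^{g(2πi p + L)}, 2πi p + L)`, `p ∈ ℤ^t` -/

section Generic

variable {t : ℕ}

/-- Along `x_n = n v + L` with `Re g_D(v) > 0`: `Re g(x_n) ≥ (Re g_D(v)/2) n^D` for large `n`.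
[folklore] -/
theorem eventually_re_eval_ge_of_re_leadingForm_pos (g : MvPolynomial (Fin t) ℂ) (v L : Fin t → ℂ)
    (hpos : 0 < (eval v (homogeneousComponent g.totalDegree g)).re) :
    ∀ᶠ n : ℕ in atTop, (eval v (homogeneousComponent g.totalDegree g)).re / 2 * (n : ℝ) ^ g.totalDegree ≤
      (eval (fun i => (n : ℂ) * v i + L i) g).re := by
  obtain ⟨ρ, hρ, t₀, ht₀, h⟩ := eval_near_natMul_add g v (half_pos hpos)
  filter_upwards [tendsto_natCast_atTop_atTop.eventually_ge_atTop t₀,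
    (tendsto_natCast_atTop_atTop.const_mul_atTop hρ).eventually_ge_atTop ‖L‖] with n hn hnL
  have h1 := h n hn L hnL
  have hfun : ((fun i => (n : ℂ) * v i) + L) = fun i => (n : ℂ) * v i + L i := by
    funext i; simp
  rw [hfun] at h1
  have h2 : ((n : ℂ) ^ g.totalDegree * eval v (homogeneousComponent g.totalDegree g)).re =
      (n : ℝ) ^ g.totalDegree * (eval v (homogeneousComponent g.totalDegree g)).re := by
    rw [show ((n : ℂ)) ^ g.totalDegree = (((n : ℝ) ^ g.totalDegree : ℝ) : ℂ) by push_cast; ring,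
      Complex.re_ofReal_mul]
  have h3 := Complex.re_le_norm (eval (fun i => (n : ℂ) * v i + L i) g -
    (n : ℂ) ^ g.totalDegree * eval v (homogeneousComponent g.totalDegree g))
  rw [Complex.sub_re, h2] at h3
  have h4 : |(eval (fun i => (n : ℂ) * v i + L i) g -
      (n : ℂ) ^ g.totalDegree * eval v (homogeneousComponent g.totalDegree g)).re| ≤
      (eval v (homogeneousComponent g.totalDegree g)).re / 2 * (n : ℝ) ^ g.totalDegree :=
    (Complex.abs_re_le_norm _).trans h1
  rw [Complex.sub_re, h2, abs_le] at h4
  nlinarith [h4.1]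

/-- Along `x_n = n v + L` with `Re g_D(v) > 0` and `deg g ≥ 1`: `log ‖e^{g(x_n)}‖ / log n → +∞`.
[folklore] -/
theorem tendsto_log_norm_exp_eval_div_log (g : MvPolynomial (Fin t) ℂ) (hD : 0 < g.totalDegree)
    (v L : Fin t → ℂ) (hpos : 0 < (eval v (homogeneousComponent g.totalDegree g)).re) :
    Tendsto (fun n : ℕ => Real.log ‖exp (eval (fun i => (n : ℂ) * v i + L i) g)‖ / Real.log n)
      atTop atTop := by
  set c₀ : ℝ := (eval v (homogeneousComponent g.totalDegree g)).re with hc₀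
  refine tendsto_atTop_mono' atTop ?_
    ((tendsto_natCast_div_log_atTop).const_mul_atTop (half_pos hpos))
  filter_upwards [eventually_re_eval_ge_of_re_leadingForm_pos g v L hpos, eventually_gt_atTop 2]
    with n hn hn2
  have hlog : 0 < Real.log n := Real.log_pos (by exact_mod_cast (show 1 < n by omega))
  have hn1 : (1 : ℝ) ≤ n := by exact_mod_cast (show 1 ≤ n by omega)
  rw [Complex.norm_exp, Real.log_exp, mul_div_assoc', le_div_iff₀ hlog, div_mul_cancel₀ _ hlog.ne']
  have hpow : (n : ℝ) ≤ (n : ℝ) ^ g.totalDegree := le_self_pow₀ hn1 hD.ne'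
  nlinarith [hpos.le]

/-- **Genericity of the limit family.**  `deg g ≥ 1`, a lattice direction `ℓ₀` (all `ℓ₀ⱼ ≠ 0`)
with `Re g_D(2πi ℓ₀) ≠ 0`, `L ∈ ℂ^t` arbitrary: no nonzero `G ∈ ℂ[W, R₁..R_t]` vanishes at
`(e^{g(r_p)}, r_p)` for every `r_p = 2πi p + L`, `p ∈ ℤ^t` (THEOREM K₀′ or J₀′ along `p = n ℓ`,
`ℓ` in the open cone of `ℓ₀`, Zariski dense by `coneLatticeDirections_dense`). (new) -/
theorem invariantDirection_limits_generic (g : MvPolynomial (Fin t) ℂ) (hD : 0 < g.totalDegree)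
    (ℓ₀ : Fin t → ℤ)
    (hℓ₀ : (eval (fun j => 2 * Real.pi * I * (ℓ₀ j : ℂ)) (homogeneousComponent g.totalDegree g)).re ≠ 0)
    (hℓ₀0 : ∀ j, ℓ₀ j ≠ 0) (L : Fin t → ℂ) (G : MvPolynomial (Fin (t + 1)) ℂ) (hG : G ≠ 0) :
    ∃ p : Fin t → ℤ, eval (Fin.cons (exp (eval (fun j => 2 * Real.pi * I * (p j : ℂ) + L j) g))
      (fun j => 2 * Real.pi * I * (p j : ℂ) + L j) : Fin (t + 1) → ℂ) G ≠ 0 := by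
  classical
  have hLhom : (homogeneousComponent g.totalDegree g).IsHomogeneous g.totalDegree :=
    homogeneousComponent_isHomogeneous _ _
  -- the sequences along a direction `v`
  set x : (Fin t → ℂ) → ℕ → Fin t → ℂ := fun v n i => (n : ℂ) * v i + L i with hx
  set w : (Fin t → ℂ) → ℕ → ℂ := fun v n => exp (eval (x v n) g) with hw
  have hxv : ∀ v : Fin t → ℂ, ∀ ρ : ℝ, 0 < ρ → ∀ᶠ n : ℕ in atTop,
      ‖x v n - fun i => (n : ℂ) * v i‖ ≤ ρ * n := by
    intro v ρ hρ
    filter_upwards [(tendsto_natCast_atTop_atTop.const_mul_atTop hρ).eventually_ge_atTop ‖L‖]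
      with n hn
    have : (x v n - fun i => (n : ℂ) * v i) = L := by funext i; simp [hx]
    rwa [this]
  have hw0 : ∀ v : Fin t → ℂ, ∀ᶠ n : ℕ in atTop, w v n ≠ 0 := fun v =>
    Eventually.of_forall fun n => Complex.exp_ne_zero _
  -- conclusion from a good direction `v = 2πi ℓ` and a good index `n`: `p = n ℓ`
  have hconcl : ∀ (ℓ : Fin t → ℤ) (n : ℕ),
      eval (Fin.cons (w (fun i => 2 * Real.pi * I * (ℓ i : ℂ)) n)
        (x (fun i => 2 * Real.pi * I * (ℓ i : ℂ)) n) : Fin (t + 1) → ℂ) G ≠ 0 →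
      ∃ p : Fin t → ℤ, eval (Fin.cons (exp (eval (fun j => 2 * Real.pi * I * (p j : ℂ) + L j) g))
        (fun j => 2 * Real.pi * I * (p j : ℂ) + L j) : Fin (t + 1) → ℂ) G ≠ 0 := by
    intro ℓ n hn
    refine ⟨fun j => (n : ℤ) * ℓ j, ?_⟩
    dsimp only
    have hxe : (fun i => (n : ℂ) * (2 * Real.pi * I * (ℓ i : ℂ)) + L i) =
        fun j => 2 * Real.pi * I * (((n : ℤ) * ℓ j : ℤ) : ℂ) + L j := by
      funext j; push_cast; ring
    simp only [hw, hx] at hn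
    rwa [hxe] at hn
  rcases lt_or_gt_of_ne hℓ₀ with hneg | hpos
  · -- decay: THEOREM J₀′
    set Q : Set (Fin t → ℂ) := {v | ∃ ℓ : Fin t → ℤ, (v = fun i => 2 * Real.pi * I * (ℓ i : ℂ)) ∧
      (eval (fun i => 2 * Real.pi * I * (ℓ i : ℂ)) (homogeneousComponent g.totalDegree g)).re < 0}
      with hQ
    have hQd : ∀ G' : MvPolynomial (Fin t) ℂ, G' ≠ 0 → ∃ v ∈ Q, eval v G' ≠ 0 := by
      intro G' hG'
      obtain ⟨ℓ, hℓ, -, hℓG⟩ := coneLatticeDirections_dense hLhom hneg hℓ₀0 G' hG'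
      exact ⟨_, ⟨ℓ, rfl, hℓ⟩, hℓG⟩
    obtain ⟨v, ⟨ℓ, rfl, hℓ⟩, hv⟩ := exists_mem_directionalComponents_ne_zero G hQd
    have hdecay : Tendsto (fun n : ℕ => -Real.log ‖w (fun i => 2 * Real.pi * I * (ℓ i : ℂ)) n‖ /
        Real.log n) atTop atTop := by
      -- `-g` has positive leading real part at `v`
      have hneg' : 0 < (eval (fun i => 2 * Real.pi * I * (ℓ i : ℂ))
          (homogeneousComponent (-g).totalDegree (-g))).re := by
        rw [totalDegree_neg, map_neg, map_neg, Complex.neg_re]; linarith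
      have h := tendsto_log_norm_exp_eval_div_log (-g) (by rwa [totalDegree_neg]) _ L hneg'
      refine h.congr fun n => ?_
      simp only [hw, hx, map_neg, Complex.norm_exp, Real.log_exp, Complex.neg_re, neg_div]
    have hev := eventually_eval_cons_ne_zero_of_directional_decay G hG hv (hxv _) (hw0 _) hdecay
    obtain ⟨n, hn⟩ := hev.exists
    exact hconcl ℓ n hn
  · -- explosion: THEOREM K₀′
    set Q : Set (Fin t → ℂ) := {v | ∃ ℓ : Fin t → ℤ, (v = fun i => 2 * Real.pi * I * (ℓ i : ℂ)) ∧
      0 < (eval (fun i => 2 * Real.pi * I * (ℓ i : ℂ)) (homogeneousComponent g.totalDegree g)).re}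
      with hQ
    have hLhom' : (-homogeneousComponent g.totalDegree g).IsHomogeneous g.totalDegree := hLhom.neg
    have hneg0 : (eval (fun j => 2 * Real.pi * I * (ℓ₀ j : ℂ))
        (-homogeneousComponent g.totalDegree g)).re < 0 := by
      rw [map_neg, Complex.neg_re]; linarith
    have hQd : ∀ G' : MvPolynomial (Fin t) ℂ, G' ≠ 0 → ∃ v ∈ Q, eval v G' ≠ 0 := by
      intro G' hG'
      obtain ⟨ℓ, hℓ, -, hℓG⟩ := coneLatticeDirections_dense hLhom' hneg0 hℓ₀0 G' hG'
      refine ⟨_, ⟨ℓ, rfl, ?_⟩, hℓG⟩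
      rw [map_neg, Complex.neg_re] at hℓ; linarith
    have hgrow : ∀ v ∈ Q, Tendsto (fun n : ℕ => Real.log ‖w v n‖ / Real.log n) atTop atTop := by
      rintro v ⟨ℓ, rfl, hℓ⟩
      exact tendsto_log_norm_exp_eval_div_log g hD _ L hℓ
    obtain ⟨v, ⟨ℓ, rfl, hℓ⟩, hev⟩ := exists_eventually_eval_cons_ne_zero_of_directional_explosion G hG
      hQd x w (fun v _ => hxv v) (fun v _ => hw0 v) hgrow
    obtain ⟨n, hn⟩ := hev.exists
    exact hconcl ℓ n hn

end Generic

end Summit.Schanuel.Schanuel.Theorems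

end
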